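import Mathlib
import Literature.Analysis.FluidPDE.SelfSimilar
import Literature.Analysis.FluidPDE.TypeIAncientMild
import Literature.Analysis.FluidPDE.ChaeWolfRemovingDSSLimit
import Literature.Analysis.FluidPDE.ChaeWolfRemovingDSSProofs
import Literature.Analysis.FluidPDE.ClassicalSolutionRescale
import Summits.NavierStokesRegularity.NavierStokesRegularity.Theorems.FilamentSkeletonRssRdssProfileTruncationRescale
import Summits.NavierStokesRegularity.NavierStokesRegularity.Theorems.DssFarFieldSlavingBlowupTypeIDssProfileFiniteOrderTwist
import Summits.NavierStokesRegularity.NavierStokesRegularity.Theorems.DssFarFieldSlavingBlowupTypeIDssProfileSyndeticReturns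
import HarnessLib

/-!
# The fixed-twist near-identity cell of the Type-I rotated-DSS class is empty
(pub-ns-dss theory seat T13 / lane X-b∞; tree-ready extraction of `HOME/theory/LiouvilleSideSketch.lean`
§5a, §5a′, §5k, v2.0 — theory file `HOME/theory/FixedTwistEmpty.lean`, sha256[16] e4168f992c963404 — landed by
the typer `--supports stmt-NavierStokesRegularity-0155`; route `DssFarFieldSlaving`, crux `BlowupTypeIDssProfile`.
Typer changes: the `def`s `SyndeticReturns` / `RemovingRdssFixedTwist` are unfolded into explicit theorem
statements; the twisted-DSS algebra and the recurrence input are the tree's `isRotatedDSS_pow`,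
`isRotatedDSS_nsRescale`, `syndeticReturns`; the class-level step is `rdssClass_removing_fixedTwist_of_classical`).

HONEST FRAMING. This file proves a Liouville / rigidity theorem for ONE CELL of the profile census
(fixed twist `R`, scaling factor `c` close to `1`, closeness depending on `R` and on the Type-I bound).
It is NOT a statement about the summit, NOT uniform in the twist (the window `c → 1⁺` with `R` free is
Pineau–Vicol's open problem), and the threshold `c₁` is ineffective.

MAIN THEOREM `removingRdssFixedTwist` (classical level): for every `C₀ > 0` and every linear isometry
`R` of `(EuclideanSpace ℝ (Fin 3))` there is `c₁ > 1` such that every classical solution `(u, p)` of Navier–Stokes (`ν = 1`,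
`f = 0`) on `(EuclideanSpace ℝ (Fin 3)) × (−∞, 0)` with the Type-I bound `‖u(t,x)‖ ≤ C₀ / (‖x‖ + √(−t))` which is
`(c, R)`-rotated discretely self-similar (`c • R⁻¹ u(c² t, c R x) = u(t, x)`) with `1 < c < c₁`
vanishes identically. COROLLARY `rdssClass_fixedTwist_nearIdentity_ae_zero` (CLASS level, hypotheses
H1–H5 of `FilamentSkeletonRss.RdssProfileTruncation` verbatim). For `R = 1` this is Chae–Wolf 2017
Thm 1.3 (in tree: `ChaeWolf.removing_dss_singularity`); for `R` of finite order `q` it follows from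
Chae–Wolf applied to `(c^q, 1)`; for `R` of INFINITE order (irrational twist angle) it is, as far as
corpus + galaxy searches show (2026-08-22, theory/LANE-X.md), NEW — novelty label (cell discipline (v)):
NEW-COMBINATION (Chae–Wolf compactness + syndetic returns of a compact group rotation).

PROOF: suppose not; Chae–Wolf's small-Type-I gap (`ChaeWolf.exists_eps_typeI_small_eq_zero`) and a
continuous parabolic rescaling (which preserves `(c, R)`-RDSS, `isRotatedDSS_nsRescale`) give
witnesses at time `−1` in a fixed ball (`rdss_rescaledWitness`); the Chae–Wolf compactness scheme
(`ChaeWolf.exists_uniform_lipschitz`, Arzelà–Ascoli, `isBoundedWeakNSSolutionOn_of_tendsto`) gives a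
nontrivial continuous Type-I bounded weak limit. SELF-SIMILARITY OF THE LIMIT WITHOUT TWIST
(`fixedTwistCompactness`): for `μ > 1` and a tolerance `δ`, the returns of `R` to `δ`-neighbourhoods of
the identity are SYNDETIC with some gap `g(δ)` (`syndeticReturns`: the powers of `R` form a totally
bounded set of operators), so the Chae–Wolf exponent `k⁰_n` (`c_n^{k⁰_n} ≤ μ < c_n^{k⁰_n+1}`) can be
moved to a return time `k_n ∈ [k⁰_n, k⁰_n + g]` at the cost of a factor `c_n^{g+1} → 1`; along these
exponents the twisted identity `u_n = λ_n • (R^{k_n+1})⁻¹ u_n(λ_n² ·, λ_n R^{k_n+1} ·)`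
(`isRotatedDSS_pow`) is `O(δ)`-close to the untwisted one, uniformly on compacts (Type-I sup
bound + uniform spatial Lipschitz bound), hence the limit satisfies `‖v − μ • v(μ² ·, μ ·)‖ ≤ A δ` for
every `δ > 0`. Chae–Wolf's end of proof (`ChaeWolf.limit_eq_zero`: Tsai + backward uniqueness, in
tree) kills the limit. [cite: ChaeWolf2017RemovingDSS, Thm 1.3 proof §3 (arXiv:1610.09464 pp. 8–9)]
[cite: PineauVicol2026, Thm 1.7 + Remark 1.8 (arXiv:2607.09619 p. 5)]
-/


noncomputable section

set_option linter.dupNamespace false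

namespace Summit.NavierStokesRegularity.NavierStokesRegularity.Theorems.FixedTwistEmpty

open MeasureTheory Set Function Filter Metric
open scoped NNReal
open Literature.Analysis.FluidPDE
open Summit.NavierStokesRegularity.NavierStokesRegularity.Theorems
open scoped Topology

/-! ## The classical theorem -/

/-- Step (2): a nontrivial classical Type-I RDSS solution, parabolically rescaled, has a Chae–Wolf
witness at `t = −1` in the ball of radius `2 C₀ / ε₀` (same constant, same `(c, R)`). -/
theorem rdss_rescaledWitness {ε₀ C₀ : ℝ} (hε₀ : 0 < ε₀) (hC₀ : 0 ≤ C₀)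
    (hε : ∀ {C : ℝ} {u : ℝ → (EuclideanSpace ℝ (Fin 3)) → (EuclideanSpace ℝ (Fin 3))} {p : ℝ → (EuclideanSpace ℝ (Fin 3)) → ℝ}, 0 ≤ C →
      IsClassicalNSSolutionOn (Iio 0) 1 0 u p → HasTypeIDecay C u →
      (∀ t < 0, ∀ x, √(-t) * ‖u t x‖ ≤ ε₀) → ∀ t < 0, ∀ x, u t x = 0)
    {c : ℝ} {R : (EuclideanSpace ℝ (Fin 3)) ≃ₗᵢ[ℝ] (EuclideanSpace ℝ (Fin 3))} {u : ℝ → (EuclideanSpace ℝ (Fin 3)) → (EuclideanSpace ℝ (Fin 3))} {p : ℝ → (EuclideanSpace ℝ (Fin 3)) → ℝ}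
    (hsol : IsClassicalNSSolutionOn (Iio 0) 1 0 u p) (hI : HasTypeIDecay C₀ u)
    (hdss : IsRotatedDSS c R u) (hne : ¬ ∀ t < 0, ∀ x, u t x = 0) :
    ∃ (l : ℝ) (q : ℝ → (EuclideanSpace ℝ (Fin 3)) → ℝ), 0 < l ∧ IsClassicalNSSolutionOn (Iio 0) 1 0 (nsRescale l u) q ∧
      HasTypeIDecay C₀ (nsRescale l u) ∧ IsRotatedDSS c R (nsRescale l u) ∧
      ∃ x : (EuclideanSpace ℝ (Fin 3)), ‖x‖ ≤ 2 * C₀ / ε₀ ∧ ε₀ / 2 ≤ ‖nsRescale l u (-1) x‖ := by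
  -- a point with `√(−t₀) ‖u(t₀,x₀)‖ > ε₀`
  have hpt : ∃ t₀ < (0 : ℝ), ∃ x₀ : (EuclideanSpace ℝ (Fin 3)), ε₀ < √(-t₀) * ‖u t₀ x₀‖ := by
    by_contra h
    push Not at h
    exact hne (hε hC₀ hsol hI h)
  obtain ⟨t₀, ht₀, x₀, hx₀⟩ := hpt
  set l : ℝ := √(-t₀) with hl
  have hl0 : 0 < l := Real.sqrt_pos.2 (by linarith)
  have hl2 : l ^ 2 = -t₀ := Real.sq_sqrt (by linarith)
  -- the rescaled classical solution on `(−∞, 0)`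
  have h1 := IsClassicalNSSolutionOn.nsRescale_holds hsol hl0
  have hS : (fun t : ℝ => l ^ 2 * t) ⁻¹' Iio (0 : ℝ) = Iio 0 := by
    ext s
    simp only [mem_preimage, mem_Iio]
    constructor
    · intro h
      by_contra hs
      have : 0 ≤ l ^ 2 * s := mul_nonneg (sq_nonneg l) (not_lt.1 hs)
      linarith
    · exact fun h => mul_neg_of_pos_of_neg (by positivity) h
  rw [nsRescaleForce_zero, hS] at h1
  refine ⟨l, nsRescalePressure l p, hl0, h1, hI.nsRescale hl0, isRotatedDSS_nsRescale hdss l, l⁻¹ • x₀, ?_⟩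
  -- the witness at `t = −1`
  have hval : nsRescale l u (-1) (l⁻¹ • x₀) = l • u t₀ x₀ := by
    rw [nsRescale_apply, smul_smul, mul_inv_cancel₀ hl0.ne', one_smul, mul_neg_one, hl2, neg_neg]
  have hq : ε₀ < √(-(-1 : ℝ)) * ‖nsRescale l u (-1) (l⁻¹ • x₀)‖ := by
    rw [neg_neg, Real.sqrt_one, one_mul, hval, norm_smul, Real.norm_of_nonneg hl0.le]
    exact hx₀
  have hmem : (-1 : ℝ) ∈ Icc (-(1 : ℝ) ^ 2) (-1) := by norm_num
  exact ChaeWolf.witness_of_point hε₀ hC₀ zero_le_one (by norm_num) (hI.nsRescale hl0) hmem hq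

/-- **Compactness with a fixed twist (PROVED).** A sequence of classical Type-I(`C₀`) solutions on
`(EuclideanSpace ℝ (Fin 3)) × (−∞,0)`, `(c_n, R)`-RDSS with a FIXED twist `R` and factors `c_n → 1⁺`, nontrivial at `t = −1`
inside a fixed ball, has a continuous, Type-I, bounded-weak, **self-similar without twist**
(`v = μ • v(μ² ·, μ ·)` for all `μ ≥ 1`), nontrivial limit. Chae–Wolf's `exists_limit` with the
self-similarity paragraph run on exponents that are RETURN TIMES of `R`. -/
theorem fixedTwistCompactness {C₀ ε₀ : ℝ} (hC₀ : 0 < C₀) (hε₀ : 0 < ε₀)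
    (R : (EuclideanSpace ℝ (Fin 3)) ≃ₗᵢ[ℝ] (EuclideanSpace ℝ (Fin 3))) {c : ℕ → ℝ} {u : ℕ → ℝ → (EuclideanSpace ℝ (Fin 3)) → (EuclideanSpace ℝ (Fin 3))} {p : ℕ → ℝ → (EuclideanSpace ℝ (Fin 3)) → ℝ}
    (hc1 : ∀ n, 1 < c n) (hc_lim : Tendsto c atTop (𝓝 1))
    (hcl : ∀ j, IsClassicalNSSolutionOn (Iio 0) 1 0 (u j) (p j))
    (hI : ∀ j, HasTypeIDecay C₀ (u j)) (hdss : ∀ j, IsRotatedDSS (c j) R (u j))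
    (hwit : ∀ j, ∃ x : (EuclideanSpace ℝ (Fin 3)), ‖x‖ ≤ 2 * C₀ / ε₀ ∧ ε₀ / 2 ≤ ‖u j (-1) x‖) :
    ∃ v : ℝ → (EuclideanSpace ℝ (Fin 3)) → (EuclideanSpace ℝ (Fin 3)), Continuous (uncurry v) ∧
      (∀ t ≤ -(1 / 4 : ℝ), ∀ x, ‖v t x‖ ≤ C₀ / (‖x‖ + Real.sqrt (-t))) ∧
      IsBoundedWeakNSSolutionOn (Iio 0) isOpen_Iio 1 (fun t => v (t - 1 / 4)) ∧
      (∀ μ : ℝ, 1 ≤ μ → ∀ t ≤ -(1 / 4 : ℝ), ∀ x, v t x = μ • v (μ ^ 2 * t) (μ • x)) ∧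
      ∃ x : (EuclideanSpace ℝ (Fin 3)), v (-1) x ≠ 0 := by
  obtain ⟨K, L, hK, hL, hKL⟩ := ChaeWolf.exists_uniform_lipschitz hC₀.le
  -- the equi-Lipschitz family on `ℝ × (EuclideanSpace ℝ (Fin 3))` (fields frozen at time `-1/4` for later times)
  set Kx : ℝ≥0 := (K + L).toNNReal with hKx
  have hKx' : (Kx : ℝ) = K + L := by rw [hKx, Real.coe_toNNReal _ (by positivity)]
  set f : ℕ → ℝ × (EuclideanSpace ℝ (Fin 3)) → (EuclideanSpace ℝ (Fin 3)) := fun n q => u n (min q.1 (-(1 / 4 : ℝ))) q.2 with hf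
  have hf_of_le : ∀ n {t : ℝ} (_ : t ≤ -(1 / 4 : ℝ)) (x : (EuclideanSpace ℝ (Fin 3))), f n (t, x) = u n t x :=
    fun n t ht x => by simp only [hf, min_eq_left ht]
  have hlip : ∀ n, LipschitzWith Kx (f n) := by
    intro n
    obtain ⟨hsp, htm⟩ := hKL (hcl n) (hI n)
    refine LipschitzWith.of_dist_le_mul fun q q' => ?_
    rw [hKx', dist_eq_norm, Prod.dist_eq, Real.dist_eq, dist_eq_norm]
    have hm : min q.1 (-(1 / 4 : ℝ)) ≤ -(1 / 4 : ℝ) := min_le_right _ _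
    have hm' : min q'.1 (-(1 / 4 : ℝ)) ≤ -(1 / 4 : ℝ) := min_le_right _ _
    have hmin : |min q.1 (-(1 / 4 : ℝ)) - min q'.1 (-(1 / 4 : ℝ))| ≤ |q.1 - q'.1| := by
      refine (abs_min_sub_min_le_max _ _ _ _).trans (max_le le_rfl ?_)
      rw [sub_self, abs_zero]; exact abs_nonneg _
    calc ‖u n (min q.1 (-(1 / 4))) q.2 - u n (min q'.1 (-(1 / 4))) q'.2‖
        ≤ ‖u n (min q.1 (-(1 / 4))) q.2 - u n (min q.1 (-(1 / 4))) q'.2‖ +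
            ‖u n (min q.1 (-(1 / 4))) q'.2 - u n (min q'.1 (-(1 / 4))) q'.2‖ :=
          norm_sub_le_norm_sub_add_norm_sub _ _ _
      _ ≤ K * ‖q.2 - q'.2‖ + L * |min q.1 (-(1 / 4 : ℝ)) - min q'.1 (-(1 / 4 : ℝ))| :=
          add_le_add (hsp _ hm _ _) (htm _ hm' _ hm _)
      _ ≤ K * max |q.1 - q'.1| ‖q.2 - q'.2‖ + L * max |q.1 - q'.1| ‖q.2 - q'.2‖ := by
          gcongr
          · exact le_max_right _ _
          · exact hmin.trans (le_max_left _ _)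
      _ = (K + L) * max |q.1 - q'.1| ‖q.2 - q'.2‖ := by ring
  have hball : ∀ n q, f n q ∈ closedBall (0 : (EuclideanSpace ℝ (Fin 3))) (2 * C₀) := fun n q => by
    rw [mem_closedBall, dist_zero_right]
    exact ChaeWolf.typeI_norm_le_two_mul hC₀.le (hI n) (min_le_right _ _) _
  obtain ⟨φ, l, hφ, hl, -, hlim⟩ := exists_strictMono_tendsto_of_lipschitzWith f hlip hball
  -- the limit field
  set v : ℝ → (EuclideanSpace ℝ (Fin 3)) → (EuclideanSpace ℝ (Fin 3)) := fun t x => l (t, x) with hv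
  have hlimv : ∀ {t : ℝ} (_ : t ≤ -(1 / 4 : ℝ)) (x : (EuclideanSpace ℝ (Fin 3))),
      Tendsto (fun n => u (φ n) t x) atTop (𝓝 (v t x)) := by
    intro t ht x
    simpa only [hf_of_le _ ht] using hlim (t, x)
  have hvc : Continuous (uncurry v) := by
    have e : uncurry v = l := by funext q; rfl
    rw [e]; exact hl.continuous
  refine ⟨v, hvc, ?_, ?_, ?_, ?_⟩
  · -- the Type I bound passes to the limit
    intro t ht x
    exact le_of_tendsto' (hlimv ht x).norm fun n => hI (φ n) t (by linarith) x
  · -- bounded weak solution on `(-∞, -1/4)`, shifted to `(-∞, 0)`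
    have hA' : Tendsto (fun k : ℕ => -(k : ℝ) + -1) atTop atBot :=
      (tendsto_neg_atTop_atBot.comp tendsto_natCast_atTop_atTop).atBot_add tendsto_const_nhds
    have e14 : ∀ t : ℝ, t - 1 / 4 = t + -(1 / 4 : ℝ) := fun t => by ring
    have hV : ∀ k : ℕ, IsBoundedWeakNSSolutionOn (Ioo (-(k : ℝ) + -1) 0) isOpen_Ioo 1
        (fun t => u (φ k) (t - 1 / 4)) := by
      intro k
      have hcl' : IsClassicalNSSolutionOn (Ioo (-(k : ℝ) + -1 + -(1 / 4)) (-(1 / 4))) 1 0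
          (u (φ k)) (p (φ k)) :=
        (hcl (φ k)).mono (fun t ht => by simp only [mem_Iio]; linarith [ht.2])
          (uniqueDiffOn_Ioo _ _)
      have hbdd : IsBoundedOn (Ioo (-(k : ℝ) + -1 + -(1 / 4)) (-(1 / 4))) (u (φ k)) :=
        ⟨2 * C₀, fun t ht x => ChaeWolf.typeI_norm_le_two_mul hC₀.le (hI (φ k)) ht.2.le x⟩
      have h := (hcl'.isBoundedWeakNSSolutionOn hbdd).comp_add_right (-(1 / 4 : ℝ))
        (J := Ioo (-(k : ℝ) + -1) 0) isOpen_Ioo fun t => by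
          simp only [mem_Ioo]
          constructor <;> intro h <;> constructor <;> linarith [h.1, h.2]
      simpa only [e14] using h
    have hcont : ∀ k : ℕ, ContinuousOn (uncurry fun t => u (φ k) (t - 1 / 4))
        (Ioo (-(k : ℝ) + -1) 0 ×ˢ univ) := by
      intro k
      have h1 := ((hcl (φ k)).smooth_velocity.comp_add_right (-(1 / 4 : ℝ))).continuousOn
      refine (h1.mono (prod_mono (fun t ht => ?_) Subset.rfl)).congr fun q _ => by
        simp only [uncurry, e14]
      simp only [mem_preimage, mem_Iio]
      linarith [ht.2]
    have hbd : ∀ k : ℕ, ∀ t ∈ Ioo (-(k : ℝ) + -1) 0, ∀ x,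
        ‖u (φ k) (t - 1 / 4) x‖ ≤ 2 * C₀ :=
      fun k t ht x => ChaeWolf.typeI_norm_le_two_mul hC₀.le (hI (φ k)) (by linarith [ht.2]) x
    have hvc' : Continuous (uncurry fun t x => v (t - 1 / 4) x) :=
      hvc.comp ((continuous_fst.sub continuous_const).prodMk continuous_snd)
    exact isBoundedWeakNSSolutionOn_of_tendsto hA' hV hcont hbd hvc'
      fun t ht x => hlimv (by linarith) x
  · -- self-similarity of the limit: extraction exponents restricted to the RETURN TIMES of `R`
    intro μ hμ t ht x
    rcases hμ.eq_or_lt with rfl | hμ1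
    · simp
    have ht0 : t ≤ 0 := by linarith
    refine eq_of_forall_dist_le fun ε hε => ?_
    -- tolerance for the returns
    set A : ℝ := μ * (2 * C₀ + K * μ * ‖x‖) with hA
    have hK0 : 0 ≤ K := by positivity
    have hA0 : 0 ≤ A := by positivity
    set δ : ℝ := ε / (A + 1) with hδ
    have hδ0 : 0 < δ := by positivity
    have hAδ : A * δ ≤ ε := by
      have h1 : A * δ ≤ (A + 1) * δ := by nlinarith
      have h2 : (A + 1) * δ = ε := by rw [hδ]; field_simp
      linarith
    obtain ⟨g, hg⟩ := syndeticReturns R hδ0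
    choose kret hkret1 hkret2 hkret3 using hg
    -- base exponents `c_n^{k⁰} ≤ μ < c_n^{k⁰+1}` and return exponents `k n ∈ [k⁰, k⁰ + g]`
    choose k0 hk0 using fun n => exists_nat_pow_near hμ (hc1 n)
    set k : ℕ → ℕ := fun n => kret (k0 n) with hk
    set lam : ℕ → ℝ := fun n => c n ^ (k n + 1) with hlam
    have hlam1 : ∀ n, 1 ≤ lam n := fun n => one_le_pow₀ (hc1 n).le
    have hlam0 : ∀ n, 0 ≤ lam n := fun n => zero_le_one.trans (hlam1 n)
    have hμlam : ∀ n, μ ≤ lam n := fun n => by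
      have h1 : k0 n + 1 ≤ k n + 1 := by have := hkret1 (k0 n); simp only [hk]; omega
      exact (hk0 n).2.le.trans (pow_le_pow_right₀ (hc1 n).le h1)
    have hlamμ : ∀ n, lam n ≤ μ * c n ^ (g + 1) := fun n => by
      have h1 : lam n ≤ c n ^ (k0 n + (g + 1)) :=
        pow_le_pow_right₀ (hc1 n).le (by have := hkret2 (k0 n); simp only [hk]; omega)
      rw [pow_add] at h1
      exact h1.trans (mul_le_mul_of_nonneg_right (hk0 n).1 (pow_nonneg (by linarith [hc1 n]) _))
    have hlam_lim : Tendsto lam atTop (𝓝 μ) := by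
      have h0 : Tendsto (fun n => μ * c n ^ (g + 1)) atTop (𝓝 μ) := by
        have := (hc_lim.pow (g + 1)).const_mul μ
        simpa using this
      exact tendsto_of_tendsto_of_tendsto_of_le_of_le tendsto_const_nhds h0 hμlam hlamμ
    have hlamφ : Tendsto (fun n => lam (φ n)) atTop (𝓝 μ) := hlam_lim.comp hφ.tendsto_atTop
    -- the moving points stay in `t ≤ -1/4`
    have hmem : ∀ s : ℝ, 1 ≤ s → s ^ 2 * t ≤ -(1 / 4 : ℝ) := fun s hs =>
      (mul_le_of_one_le_left ht0 (one_le_pow₀ hs)).trans ht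
    -- the TWISTED DSS identity along the sequence is `δ`-close to the untwisted one
    have hdist : ∀ n, dist (u n t x) (lam n • u n (lam n ^ 2 * t) (lam n • x)) ≤
        lam n * (2 * C₀ * δ + K * lam n * ‖x‖ * δ) := by
      intro n
      set S : (EuclideanSpace ℝ (Fin 3)) ≃ₗᵢ[ℝ] (EuclideanSpace ℝ (Fin 3)) := R ^ (k n + 1) with hS
      have hid : u n t x = lam n • S.symm (u n (lam n ^ 2 * t) (lam n • S x)) :=
        (isRotatedDSS_pow (hdss n) (k n + 1) t x).symm
      have hτ : lam n ^ 2 * t ≤ -(1 / 4 : ℝ) := hmem _ (hlam1 n)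
      have hret : ∀ y : (EuclideanSpace ℝ (Fin 3)), ‖S y - y‖ ≤ δ * ‖y‖ := fun y => hkret3 (k0 n) y
      set w₁ : (EuclideanSpace ℝ (Fin 3)) := u n (lam n ^ 2 * t) (lam n • S x) with hw₁
      set w₂ : (EuclideanSpace ℝ (Fin 3)) := u n (lam n ^ 2 * t) (lam n • x) with hw₂
      have e1 : ‖S.symm w₁ - w₁‖ ≤ δ * (2 * C₀) := by
        have h := hret (S.symm w₁)
        rw [LinearIsometryEquiv.apply_symm_apply, LinearIsometryEquiv.norm_map, norm_sub_rev] at h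
        exact h.trans (mul_le_mul_of_nonneg_left
          (ChaeWolf.typeI_norm_le_two_mul hC₀.le (hI n) hτ _) hδ0.le)
      have e2 : ‖w₁ - w₂‖ ≤ K * (lam n * (δ * ‖x‖)) := by
        have h := (hKL (hcl n) (hI n)).1 _ hτ (lam n • S x) (lam n • x)
        refine h.trans (mul_le_mul_of_nonneg_left ?_ hK0)
        rw [← smul_sub, norm_smul, Real.norm_of_nonneg (hlam0 n)]
        exact mul_le_mul_of_nonneg_left (hret x) (hlam0 n)
      rw [hid, dist_eq_norm, ← smul_sub, norm_smul, Real.norm_of_nonneg (hlam0 n)]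
      refine mul_le_mul_of_nonneg_left ?_ (hlam0 n)
      calc ‖S.symm w₁ - w₂‖ ≤ ‖S.symm w₁ - w₁‖ + ‖w₁ - w₂‖ := norm_sub_le_norm_sub_add_norm_sub _ _ _
        _ ≤ δ * (2 * C₀) + K * (lam n * (δ * ‖x‖)) := add_le_add e1 e2
        _ = 2 * C₀ * δ + K * lam n * ‖x‖ * δ := by ring
    -- pass to the limit along `φ`
    set q : ℕ → ℝ × (EuclideanSpace ℝ (Fin 3)) := fun n => (lam (φ n) ^ 2 * t, lam (φ n) • x) with hq
    have hqlim : Tendsto q atTop (𝓝 (μ ^ 2 * t, μ • x)) :=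
      ((hlamφ.pow 2).mul_const t).prodMk_nhds (hlamφ.smul tendsto_const_nhds)
    have h1 : Tendsto (fun n => f (φ n) (q n)) atTop (𝓝 (v (μ ^ 2 * t) (μ • x))) :=
      ChaeWolf.tendsto_apply_of_tendsto (fun n => hlip (φ n)) hqlim (hlim (μ ^ 2 * t, μ • x))
    have h2 : Tendsto (fun n => lam (φ n) • u (φ n) (lam (φ n) ^ 2 * t) (lam (φ n) • x)) atTop
        (𝓝 (μ • v (μ ^ 2 * t) (μ • x))) := by
      refine (hlamφ.smul h1).congr fun n => ?_
      simp only [hq, hf_of_le _ (hmem _ (hlam1 _))]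
    have h3 : Tendsto (fun n => lam (φ n) * (2 * C₀ * δ + K * lam (φ n) * ‖x‖ * δ)) atTop
        (𝓝 (μ * (2 * C₀ * δ + K * μ * ‖x‖ * δ))) :=
      hlamφ.mul (tendsto_const_nhds.add
        (((tendsto_const_nhds.mul hlamφ).mul tendsto_const_nhds).mul tendsto_const_nhds))
    have h4 := le_of_tendsto_of_tendsto' ((hlimv ht x).dist h2) h3 fun n => hdist (φ n)
    calc dist (v t x) (μ • v (μ ^ 2 * t) (μ • x)) ≤ μ * (2 * C₀ * δ + K * μ * ‖x‖ * δ) := h4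
      _ = A * δ := by rw [hA]; ring
      _ ≤ ε := hAδ
  · -- nontriviality at time `-1`
    choose y hyb hyw using hwit
    have hSc : IsCompact (closedBall (0 : (EuclideanSpace ℝ (Fin 3))) (2 * C₀ / ε₀)) := isCompact_closedBall _ _
    have hmemS : ∀ n, y (φ n) ∈ closedBall (0 : (EuclideanSpace ℝ (Fin 3))) (2 * C₀ / ε₀) := fun n => by
      rw [mem_closedBall, dist_zero_right]; exact hyb (φ n)
    obtain ⟨ybar, -, ψ, hψ, hconv⟩ := hSc.tendsto_subseq hmemS
    refine ⟨ybar, fun h0 => ?_⟩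
    have h14 : (-1 : ℝ) ≤ -(1 / 4 : ℝ) := by norm_num
    have hy0 : Tendsto (fun n => f (φ (ψ n)) ((-1 : ℝ), ybar)) atTop (𝓝 (v (-1) ybar)) :=
      (hlim ((-1 : ℝ), ybar)).comp hψ.tendsto_atTop
    have hconv' : Tendsto (fun n => ((-1 : ℝ), y (φ (ψ n)))) atTop (𝓝 ((-1 : ℝ), ybar)) :=
      tendsto_const_nhds.prodMk_nhds hconv
    have hmain := ChaeWolf.tendsto_apply_of_tendsto (fun n => hlip (φ (ψ n))) hconv' hy0
    have hge : ε₀ / 2 ≤ ‖v (-1) ybar‖ := by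
      refine ge_of_tendsto' hmain.norm fun n => ?_
      simp only [hf_of_le _ h14]
      exact hyw (φ (ψ n))
    rw [h0, norm_zero] at hge
    linarith

/-- **T13, classical form PROVED (`RemovingRdssFixedTwist` of the cell): near-identity scaling
factors with a FIXED twist are excluded.**  For every `C₀ > 0` and every linear isometry `R` of `(EuclideanSpace ℝ (Fin 3))`
there is `c₁ > 1` (depending on `C₀` and `R`, ineffective) such that every classical solution
`(u, p)` of Navier–Stokes (`ν = 1`, `f = 0`) on `(EuclideanSpace ℝ (Fin 3)) × (−∞, 0)` which is `(c, R)`-rotated discretely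
self-similar with `1 < c < c₁` and obeys `‖u(t,x)‖ ≤ C₀ / (‖x‖ + √(−t))` vanishes identically.
For `R = 1`: Chae–Wolf 2017 Thm 1.3; for `R` of infinite order: new combination (Chae–Wolf
compactness + syndetic returns). [cite: ChaeWolf2017RemovingDSS, Thm 1.3 proof §3 (arXiv:1610.09464 pp. 8–9)] -/
theorem removingRdssFixedTwist :
    ∀ C₀ : ℝ, 0 < C₀ → ∀ R : (EuclideanSpace ℝ (Fin 3)) ≃ₗᵢ[ℝ] (EuclideanSpace ℝ (Fin 3)), ∃ c₁ : ℝ, 1 < c₁ ∧ ∀ c : ℝ, 1 < c → c < c₁ →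
      ∀ (u : ℝ → (EuclideanSpace ℝ (Fin 3)) → (EuclideanSpace ℝ (Fin 3))) (p : ℝ → (EuclideanSpace ℝ (Fin 3)) → ℝ), IsClassicalNSSolutionOn (Iio 0) 1 0 u p →
        IsRotatedDSS c R u → HasTypeIDecay C₀ u → ∀ t < 0, ∀ x, u t x = 0 := by
  intro C₀ hC₀ R
  obtain ⟨ε₀, hε₀, hε⟩ := ChaeWolf.exists_eps_typeI_small_eq_zero
  by_contra H
  push Not at H
  have hpos : ∀ n : ℕ, (1 : ℝ) < 1 + 1 / ((n : ℝ) + 1) := fun n => by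
    have : (0 : ℝ) < 1 / ((n : ℝ) + 1) := by positivity
    linarith
  choose c hc1 hc2 u p hsol hdss hI t ht x hx using fun n : ℕ => H _ (hpos n)
  have hne : ∀ j, ¬ ∀ s < 0, ∀ y, u j s y = 0 := fun j h => hx j (h (t j) (ht j) (x j))
  have hwit : ∀ j, ∃ (l : ℝ) (q : ℝ → (EuclideanSpace ℝ (Fin 3)) → ℝ), 0 < l ∧
      IsClassicalNSSolutionOn (Iio 0) 1 0 (nsRescale l (u j)) q ∧
      HasTypeIDecay C₀ (nsRescale l (u j)) ∧ IsRotatedDSS (c j) R (nsRescale l (u j)) ∧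
      ∃ y : (EuclideanSpace ℝ (Fin 3)), ‖y‖ ≤ 2 * C₀ / ε₀ ∧ ε₀ / 2 ≤ ‖nsRescale l (u j) (-1) y‖ := fun j =>
    rdss_rescaledWitness hε₀ hC₀.le hε (hsol j) (hI j) (hdss j) (hne j)
  choose l q hl hsol' hI' hdss' hw using hwit
  have hc_lim : Tendsto c atTop (𝓝 1) := by
    have h0 : Tendsto (fun n : ℕ => (1 : ℝ) + 1 / ((n : ℝ) + 1)) atTop (𝓝 1) := by
      simpa using tendsto_const_nhds.add (tendsto_one_div_add_atTop_nhds_zero_nat (𝕜 := ℝ))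
    exact tendsto_of_tendsto_of_tendsto_of_le_of_le tendsto_const_nhds h0 (fun n => (hc1 n).le)
      fun n => (hc2 n).le
  obtain ⟨v, hcont, hIv, hweak, hss, y, hy⟩ :=
    fixedTwistCompactness hC₀ hε₀ R hc1 hc_lim hsol' hI' hdss' hw
  exact hy (congr_fun (ChaeWolf.limit_eq_zero hcont hIv hweak hss) y)

/-- **T13 at CLASS level (PROVED): the fixed-twist near-identity cell of the Type-I RDSS class is
EMPTY.** For every Type-I bound `M > 0` and every FIXED linear isometry `R` there is `c₁(M, R) > 1`
such that every ancient mild solution (`ν = 1`) with a.e.-strongly-measurable slices, `(c, R)`-rotated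
discretely self-similar with `1 < c < c₁` and Type-I(`M`), has a.e.-vanishing slices — i.e. it is NOT
a witness of `FilamentSkeletonRss.RdssProfileTruncation` (hypotheses H1–H5 of that statement, verbatim).
NOT uniform in `R`; `c₁` ineffective (compactness). Bridge to the classical theorem: the typer's
landed `rdssClass_removing_fixedTwist_of_classical` (classical representative at the same constant).
[cite: ChaeWolf2017RemovingDSS, Thm 1.3] -/
theorem rdssClass_fixedTwist_nearIdentity_ae_zero : ∀ M : ℝ, 0 < M → ∀ R : (EuclideanSpace ℝ (Fin 3)) ≃ₗᵢ[ℝ] (EuclideanSpace ℝ (Fin 3)),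
    ∃ c₁ : ℝ, 1 < c₁ ∧ ∀ c : ℝ, 1 < c → c < c₁ → ∀ u : ℝ → (EuclideanSpace ℝ (Fin 3)) → (EuclideanSpace ℝ (Fin 3)),
      IsAncientMildSolution 1 u → (∀ t < 0, AEStronglyMeasurable (u t) volume) →
      IsRotatedDSS c R u → HasTypeIDecay M u → ∀ t < 0, u t =ᵐ[volume] 0 := by
  intro M hM R
  obtain ⟨c₁, hc₁, h⟩ := removingRdssFixedTwist M hM R
  exact ⟨c₁, hc₁, rdssClass_removing_fixedTwist_of_classical h⟩

end Summit.NavierStokesRegularity.NavierStokesRegularity.Theorems.FixedTwistEmpty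

end
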